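import Literature.Analysis.FluidPDE.KNSSPoloidalAxisDecay
import Literature.Analysis.FluidPDE.LeiZhang2017AxisymmetricCriteria
import Literature.Analysis.FluidPDE.SpaceTimeRescaling
import Summits.NavierStokesRegularity.NavierStokesRegularity.Theorems.CertifiedBlowupCertifiedBlowupAxisymBlowupSwirlPersists
import Summits.NavierStokesRegularity.NavierStokesRegularity.Theses.CertifiedBlowup
import HarnessLib

/-!
# Two registered zoom stubs of the crux `CertifiedBlowupAxisymBlowup`: the witness's swirl bound up to the lifespan,
# and the axis re-centring identity of the rescaled zoom

Theorems file landed `--supports stmt-NavierStokesRegularity-0727` (crux `CertifiedBlowupAxisymBlowup`), registered stubs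
`zoom_witness_abs_swirl_le` and `zoom_rescaled_translate_eq` of the sub-skeleton "axis-aware KNSS sup-zoom of a witness"
(`Cruxes/CertifiedBlowupAxisymBlowup/Lines/registered_zoom_probe.lean`), stated VERBATIM as registered.

* `zoom_witness_abs_swirl_le` — for a maximal smooth solution `(u, p)` (`ν = 1`, unforced) with lifespan `T > 0`, Leray–Hopf
  from its rapidly decaying axisymmetric datum: `|Γ(u(τ))(x)| ≤ ⨆ z, |Γ(u(0))(z)|` for every `τ ∈ [0, T)`, `x` — the swirl
  maximum principle (KNSS 2009 (1.10); Chae–Lee 2002), in the tree as the DISCHARGED `abs_swirl_le_of_classical_Ico`, fed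
  with the witness's sub-slab boundedness and slice axisymmetry (`bounded_before_of_lerayHopf_classical`,
  `isAxisymmetric_slice_of_lerayHopf_classical`) and `M = ⨆ z |Γ₀(z)|`, a genuine supremum since a rapidly decaying datum has
  bounded swirl (`HasRapidSpatialDecay.abs_swirl_le`); `witness_abs_swirl_le_iSup` is the same at any viscosity `ν > 0`;
* `zoom_rescaled_translate_eq` — bookkeeping of the parabolic zoom `stPull β γ t₀ x₀ ψ (s, y) = ψ(t₀ + βs, x₀ + γy)` for a
  meridional centre (`x₀¹ = 0`): translating the zoom variable by `−c⁻¹x₀⁰e₀` moves the centre to the axis point `x₀²e_z`.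

No new definitions, no named-fact hypotheses, no `sorry`; the local notation `ℝ³` is the registered signatures' own.
WHAT THIS IS NOT: not a blow-up or regularity claim — an a-priori bound for a hypothetical witness and an algebraic identity.
Cell `ns-blowup`, zone Z1 (profile-eng-1 g9).

## References
* H. Koch, N. Nadirashvili, G. Seregin, V. Šverák, Acta Math. 203 (2009), (1.10) and §6. [KochNadirashviliSereginSverak2009]
-/

set_option linter.dupNamespace false

noncomputable section

open MeasureTheory Set Function Filter Topology Metric
open scoped NNReal ENNReal

namespace Summit.NavierStokesRegularity.NavierStokesRegularity.Theorems.CertifiedBlowupAxisymBlowup.CompactAmplification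

open Literature.Analysis Literature.Analysis.FluidPDE
open Summit.NavierStokesRegularity.NavierStokesRegularity.Theses.CertifiedBlowup

local notation "ℝ³" => EuclideanSpace ℝ (Fin 3)

/-- **Swirl maximum principle for a witness, any viscosity**: for a maximal smooth unforced solution at viscosity `ν > 0`
with lifespan `T > 0`, Leray–Hopf from its rapidly decaying axisymmetric datum, `|Γ(u(τ))(x)| ≤ ⨆ z, |Γ(u(0))(z)|` for all
`τ ∈ [0, T)`, `x`. [cite: KochNadirashviliSereginSverak2009, (1.10)] -/
theorem witness_abs_swirl_le_iSup {ν T : ℝ} {u : ℝ → ℝ³ → ℝ³} {p : ℝ → ℝ³ → ℝ} (hν : 0 < ν) (hT : 0 < T)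
    (hmax : IsMaximalSmoothSolution ν 0 u p T) (hLH : IsLerayHopfOn T ν 0 (u 0) u)
    (hdec : HasRapidSpatialDecay (u 0)) (haxi : IsAxisymmetric (u 0)) :
    ∀ τ ∈ Ico 0 T, ∀ x, |swirl (u τ) x| ≤ ⨆ z, |swirl (u 0) z| := by
  have _ := hT
  obtain ⟨C, hC⟩ := hdec.abs_swirl_le
  have hbdd : BddAbove (Set.range fun z => |swirl (u 0) z|) := ⟨C, by rintro _ ⟨z, rfl⟩; exact hC z⟩
  have hM : ∀ x, |swirl (u 0) x| ≤ ⨆ z, |swirl (u 0) z| := fun x => le_ciSup hbdd x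
  exact abs_swirl_le_of_classical_Ico hν hmax.1 (isAxisymmetric_slice_of_lerayHopf_classical hν hmax.1 hLH hdec haxi)
    (bounded_before_of_lerayHopf_classical hν hmax.1 hLH hdec haxi) hM

/-- **Registered stub `zoom_witness_abs_swirl_le`** (ν = 1): the swirl of a witness of `CertifiedBlowupAxisymBlowup` is
bounded on `[0, T) × ℝ³` by the supremum of the datum's swirl. [cite: KochNadirashviliSereginSverak2009, (1.10)] -/
theorem zoom_witness_abs_swirl_le : ∀ {T : ℝ} {u : ℝ → ℝ³ → ℝ³} {p : ℝ → ℝ³ → ℝ}, 0 < T → IsMaximalSmoothSolution 1 0 u p T → IsLerayHopfOn T 1 0 (u 0) u → HasRapidSpatialDecay (u 0) → IsAxisymmetric (u 0) → ∀ τ ∈ Ico 0 T, ∀ x, |swirl (u τ) x| ≤ ⨆ z, |swirl (u 0) z| :=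
  fun hT hmax hLH hdec haxi => witness_abs_swirl_le_iSup one_pos hT hmax hLH hdec haxi

/-- The translated centre: `x₀ + c(y − c⁻¹x₀⁰e₀) = x₀²e_z + cy` when `x₀¹ = 0`, `c ≠ 0`. [folklore] -/
theorem meridional_centre_translate {c : ℝ} {x₀ : ℝ³} (hc : c ≠ 0) (hx1 : x₀ 1 = 0) (y : ℝ³) :
    x₀ + c • (y - (c⁻¹ * x₀ 0) • EuclideanSpace.single 0 (1 : ℝ)) = (x₀ 2) • eZ + c • y := by
  ext i
  fin_cases i <;> simp [eZ, hx1, smul_sub, mul_comm, hc]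

/-- **Registered stub `zoom_rescaled_translate_eq`**: for `c ≠ 0` and a meridional centre `x₀` (`x₀¹ = 0`),
`(c • stPull (c²) c t₀ x₀ u) s (y − (c⁻¹x₀⁰) e₀) = c • u (t₀ + c²s) (x₀² e_z + c y)`. [folklore] -/
theorem zoom_rescaled_translate_eq : ∀ {u : ℝ → ℝ³ → ℝ³} {c t₀ : ℝ} {x₀ : ℝ³}, c ≠ 0 → x₀ 1 = 0 → ∀ (s : ℝ) (y : ℝ³), (c • stPull (c ^ 2) c t₀ x₀ u) s (y - (c⁻¹ * x₀ 0) • EuclideanSpace.single 0 1) = c • u (t₀ + c ^ 2 * s) ((x₀ 2) • eZ + c • y) := by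
  intro u c t₀ x₀ hc hx1 s y
  simp only [Pi.smul_apply, stPull_apply]
  rw [meridional_centre_translate hc hx1 y]

end Summit.NavierStokesRegularity.NavierStokesRegularity.Theorems.CertifiedBlowupAxisymBlowup.CompactAmplification
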